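import Summits.QuantumFields.BalabanUV.T4Continuum.Spine.NE1p.DressedTowerWitnessSliceEnd
import Summits.QuantumFields.BalabanUV.T4Continuum.Spine.NE1p.DressedStabilityOfSliceWinSchedules
import Summits.QuantumFields.BalabanUV.T4Continuum.Spine.NE1p.DressedTowerWitnessAllCutoffs

/-!
# T⁴ programme, spine estimate NE1′ (node O3b/H2) — NON-VACUITY OF THE ALL-CUTOFF ASSEMBLED SLICE-WINDOW FACE AND OF ROOT-B ON
# THE DECIDED TOYS: row W7's tower fed to the END-ALL-slice-win THEOREM ITSELF, and the co-recorded budget root `DressedBudget`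
# reached on BOTH toy towers at every cutoff (formalisation crew `b2b-balaban-t4-ne1p-formalise-*`, leaf seat 03, generation 3;
# own-initiative witness item W7c, INTENT CLAIMS.log 2026-08-20T10:06Z; NOT a crew estimate row)

Cell `pub-balaban`, sub-cell `t4`, BINDER-OWNERS row NE1′ (owner lineage t4-ne1p-p1).  ADDITIVE — imports this seat's row W7 part 2
`Spine/NE1p/DressedTowerWitnessSliceEnd` (p214558: the datum `towerM`∕`BM`∕`TM` with a LIVE generation in the observable exponent, the
ONE cutoff-free schedule `Wm = WindowScheduleModWin.geometric 1 1 ψ (ψ∕4) 1 0`, its per-cutoff binder lemmas, row W5's ONE K-free `UW`),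
leaf-09's row S3h part 2 `Spine/NE1p/DressedStabilityOfSliceWinSchedules` (p214712: the all-cutoff assembled slice-window face
`dressedStabilityWith_swin_of_schedules` ∕ `dressedBudget_swin_of_schedules`; through it S3g part 2's `dressedBudget_win_of_cell`) and
leaf-09's W5c `Spine/NE1p/DressedTowerWitnessAllCutoffs` (p214673: the W5 With-form `dressedStabilityWith_towerW_allCutoffs`, the
decay `rhoOne_towerW_lt_one`) ONLY; modifies nothing.

WHAT.  Row W7 reaches the existential root `DressedStability towerM` through END-B over row S3's `bookingLeavesCell` (part 2) and
through leaf-09's per-cutoff bundle `bookingLeaves_assembled_swin_of_schedule` (part 3).  Here: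
* §1 the SAME datum is fed to the all-cutoff theorem `dressedStabilityWith_swin_of_schedules` with EVERY hypothesis a
  `(p, K)`-FAMILY `fun _ K => …M K…`, ONE schedule `fun _ _ => Wm` and the scalars of `UW` bound ONCE — so the ≈ 45 `(p,K)`-indexed
  binder families of the END-ALL-slice-win face (S3h-2 §1) are JOINTLY INHABITED, at every cutoff, by one cutoff-free schedule and
  one K-free scalar set, and the theorem's DISPLAYED-CONSTANTS conclusion `DressedStabilityWith towerM 1 (rhoOne ψ 2 0 ½) LW⁻³` is
  reached from them (**`dressedStabilityWith_towerM_allCutoffs`**; W7's own theorems state the existential root only; the family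
  factor `rhoOne ψ 2 0 ½ < 1` is W5c's `rhoOne_towerW_lt_one` BY NAME — the same constants); `sizeBound_towerM_allCutoffs` is END's
  consumer face at every cutoff.
* §2 ROOT-B's DATA on the toys: one family felt per cube, so `PositionalCount (1·(LW⁴)^{k−j})` on `BM K` and `BW K`
  (`positionalCount_towerM`, `positionalCount_towerW`).
* §3 **ROOT-B ON THE DECIDED TOYS AT EVERY CUTOFF** — the budget face `DressedBudget` (module `DressedRootFam`), CO-RECORDED next to the root
  of record (typer R-T35 (i); formalise-ref's countersign of G-wardbootg6-1: «root namings carry the budget form alongside»), had so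
  far been reached by NO witness (W1–W7, W5c reach ROOT-C).  **`dressedBudget_towerM_allCutoffs`**: for EVERY run-weight family
  `0 ≤ wt ≤ w̄`, `DressedBudget towerM wt` by S3h-2 §2 `dressedBudget_swin_of_schedules` BY NAME (its full binder list — §1's
  families + weights + positional counts — inhabited at once); **`dressedBudget_towerW_allCutoffs`**: the same for row W5's tower by
  S3g-2's `dressedBudget_win_of_cell` over W5c's With-form BY NAME; the closed unit-weight instances `dressedBudget_towerM_one` ∕
  `dressedBudget_towerW_one`; and the budget with its CONSTANT DISPLAYED, `CubeBudget (wt K) (w̄·(1·1∕(1−½)))` at every cube of every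
  cutoff (`cubeBudget_towerM_allCutoffs`, by `cubeBudget_of_classAt_strict` (module `DressedRootFam`) over §1's class and `UW.hprod`).

HONEST FRAMING.  A decided toy ([folklore]; 0 sorry; 0 citations; no `def`): two-point fluctuation laws `flAt`, affine carried
functionals, `rel = Eq`, zero regeneration, ACTION exponent `𝒜 ≡ 0` (declared in W7 parts 1–2; the observable-attached exponent
`𝒬M` is live) — NOTHING of Bałaban's densities, windows or D-terms; the walls (w1)∕(w2-act)∕(I4′)∕(w5) and ROOT-B's count∕weight
binders are inhabited here by TOY data only.  Headline (c4): «the all-cutoff ASSEMBLED slice-window face's binder families (+ ROOT-B's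
weights ∕ positional counts) are jointly inhabitable at every cutoff; BOTH roots come out of the all-cutoff theorems themselves —
non-vacuity of binder SHAPES; NE1′ ⇐ the named binders, NOT proved»; spine PROVED 0∕9.  Rung (B)+1 on ONE finite four-torus — NOT
infinite volume, NOT a mass gap, NOT OS on ℝ⁴, NOT Clay, NOT summit progress.  HONEST DEPENDENCY: continuum YM on T⁴ ⇐ BetaPertH ∧
nine spine estimates (0/9 proved); BetaPertH ⇐ (D1) ∧ (D4) ∧ CAP+tail; G-an2-4 gates asym, D1 and NE2/3/4.
-/

noncomputable section

namespace Summit.QuantumFields.BalabanUV.T4Continuum.NE1p.DressedTowerWitnessSliceAllCutoffs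

open MeasureTheory Set Metric Filter Finset
open scoped BigOperators
open Literature.MathematicalPhysics.QuantumFieldTheory.Balaban1983to89
open Literature.MathematicalPhysics.QuantumFieldTheory.Balaban1983to89.T4TermFormat
open Literature.MathematicalPhysics.QuantumFieldTheory.Balaban1983to89.T4TermFormat.Booking
open Literature.MathematicalPhysics.QuantumFieldTheory.Balaban1983to89.T4GatedBooking
open Literature.MathematicalPhysics.QuantumFieldTheory.Balaban1983to89.T4TrajectoryComparison
open T4TrajectoryModulus (bondBall bondBall_add_mem bondBall_latMove_add_mem bondBall_diam)
open T4BlockTransport (Fld NDir latMove latN Site norm_dir_le)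
open T4BirthChartTransport (GaugeInvariant BirthSlice RelGauge)
open T4TrajectoryDensity
open Summit.QuantumFields.BalabanUV.T4Continuum.T4TrajectoryDensityDressed
open Summit.QuantumFields.BalabanUV.T4Continuum.T4TrajectoryDensityWitness
open Summit.QuantumFields.BalabanUV.T4Continuum.NE1p.DressedRoot
open Summit.QuantumFields.BalabanUV.T4Continuum.NE1p.DressedUniformConstants
open Summit.QuantumFields.BalabanUV.T4Continuum.NE1p.DressedWindowScheduleWin
open Summit.QuantumFields.BalabanUV.T4Continuum.NE1p.DressedWindowScheduleModWin
open Summit.QuantumFields.BalabanUV.T4Continuum.NE1p.DressedTowerWitness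
open Summit.QuantumFields.BalabanUV.T4Continuum.NE1p.DressedTowerWitnessSlice
open Summit.QuantumFields.BalabanUV.T4Continuum.NE1p.DressedTowerWitnessAllCutoffs
open Summit.QuantumFields.BalabanUV.T4Continuum.NE1p.DressedTransportAssembledModData
open Summit.QuantumFields.BalabanUV.T4Continuum.NE1p.DressedStabilityOfWinSchedules
open Summit.QuantumFields.BalabanUV.T4Continuum.NE1p.DressedStabilityOfSliceWinSchedules

/-! ## §1 W7's tower through the END-ALL-slice-win theorem, constants displayed [decided toy] -/

/-- **W7's TOWER THROUGH THE END-ALL-slice-win THEOREM, CONSTANTS DISPLAYED** [decided toy]: `DressedStabilityWith towerM 1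
(rhoOne LW⁻² 2 0 ½) LW⁻³` by `DressedStabilityOfSliceWinSchedules.dressedStabilityWith_swin_of_schedules` with the single cutoff-free
schedule `fun _ _ => Wm`, the scalars of `UW` (`κ = ½`, `L = LW`, `c̄ = 0`, `N₀ = A₀ = 1`, `s̄⁰ = ρ′ = ½`, `r = 1`, `c_δ = ½`, `m = ¼`)
bound ONCE, and EVERY estimate ∕ dictionary ∕ booking-level binder of the assembled slice-window face the toy's per-cutoff lemma of
row W7 as a `(p, K)`-family: births `hslM` at the per-step slice window (`birthSlice_anti_window`), the live step law `FnM_succ`,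
the H2 dictionary `hQM` with the live generation `Sg k b = {(b,0)}`, the modulus budget `s1M`∕`AszM` by `rfl`∕`aszRec_*`, the (I4′)
links `hδfM`∕`hδfwkM`∕`hdefwkM`∕`hrateM`, the fresh pairs `relGauge_pairs`, attainment `hlinM`, (w5) `hregM`, (w3-book) `hcountM`,
(w1)+(w5b) `hbirthM`.  (W7's `dressedStability_towerM` is the existential root through END-B directly; this is the displayed-constants
class through the all-cutoff theorem — a different statement, the same toy; its family factor is `< 1` by W5c's
`rhoOne_towerW_lt_one`.)  Non-vacuity of the binder SHAPES of S3h-2 §1; nothing of Bałaban's densities. [folklore] -/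
theorem dressedStabilityWith_towerM_allCutoffs :
    DressedStabilityWith towerM 1 (rhoOne (LW ^ 2)⁻¹ (4 * (1 / 2) / 1) 0 (1 / 2)) (LW⁻¹ ^ 3) :=
  dressedStabilityWith_swin_of_schedules towerM (κ := 1 / 2) (L := LW) (cbar := 0) (N₀ := 1) (A₀ := 1) (sbar := 1 / 2)
    (ρ' := 1 / 2) (r := 1) (cδ := 1 / 2) (m := 1 / 4) (w := fun _ _ => 1) (fun _ _ => Wm)
    (Fn := fun _ K _ k' k => FnM K k' k) (rel := fun _ _ _ _ _ U U' => U = U') (ref := fun _ _ _ _ U => U)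
    (base := fun _ _ _ _ => base₁) (𝒜 := fun _ _ _ _ => zeroExp) (𝒬 := fun _ K _ k => 𝒬M K k) (q := fun _ _ _ _ _ => 0)
    (μ := fun _ _ _ k => flAt (atomW (k + 1))) (z₀ := fun _ _ _ _ => 0) (z₁ := fun _ _ _ _ => 0)
    (defect := fun _ _ _ _ k => defW (k + 1)) (s := fun _ _ _ _ => 0) (s1 := fun _ K => s1M K) (Asz := fun _ K => AszM K)
    (S := fun _ _ _ b => {b}) (Sg := fun _ _ _ b => {(b, 0)}) (c := fun _ _ _ _ => (((1 / 4 : ℝ)) : ℂ))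
    (δf := fun _ _ _ k _ => dfW k) (creg := fun _ _ _ => 0)
    (fun _ _ => hratioM) one_le_LW le_rfl (by norm_num) zero_le_one zero_le_one (by norm_num) (locCell_LW _).le (by norm_num)
    (by norm_num) one_pos (by norm_num)
    (fun _ K b k' _ _ _ => birthSlice_anti_window (hslM K b k') (Wm.hwcw k'))
    (fun _ K _ k' k _ _ _ _ U => FnM_succ K k' k U) (fun _ _ _ _ k _ _ _ _ _ => mem_bddClass_flAt _ _)
    (fun _ _ _ _ k _ _ _ _ => realBaseAt_W _ _) (fun _ _ _ _ k _ _ _ _ => exponentSliceAt_M _ _ _ _)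
    (fun _ K b k => hQM K b k) (fun _ K => hSgM K) (fun _ _ _ _ => rfl)
    (fun _ K f k'' => aszRec_birth (TM K).gen (fun _ _ => 0) (s1M K) f k'')
    (fun _ K f _ _ _ hk => aszRec_succ (TM K).gen (fun _ _ => 0) (s1M K) f hk) (fun _ _ _ _ => hcmM)
    (fun _ K b k x hx => hδfM K k b x hx) (fun _ _ _ k _ _ => hδfwkM k) (fun _ _ _ k => hDμM k) (fun _ _ _ k => hz₁M k)
    (fun _ _ _ _ k _ _ _ _ U₀ _ pd _ _ => (relGauge_pairs k).mono fun z hz t _ => hz (latMove U₀ pd t))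
    (fun _ _ _ _ _ _ _ h => h ▸ rfl) (fun _ _ _ _ _ k _ => aesm_flAt _ _) (fun _ _ _ _ k => hdefwkM k)
    (fun _ _ _ k' k _ _ _ => hrateM k' k) (fun _ K b k' k _ _ _ _ ε hε => hlinM K b k' k ε hε)
    (fun _ _ _ => le_rfl) (fun _ _ _ _ => le_rfl) (fun _ K => hregM K _) (fun _ _ _ _ => by norm_num)
    (fun _ _ k _ _ _ => Nat.zero_le k) (fun _ K => hcountM K) (fun _ K => hbirthM K)

/-- [decided toy] Hence, from the displayed-constants class, every booked size of W7's toy is below `A₀ = 1` times the decaying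
two-rate profile at EVERY cutoff (END's consumer face `sizeBound_of_dressedStabilityWith` BY NAME). [folklore] -/
theorem sizeBound_towerM_allCutoffs (p : Unit) (K : ℕ) :
    (towerM.B p K).SizeBound
      (twoRate 1 (rhoOne (LW ^ 2)⁻¹ (4 * (1 / 2) / 1) 0 (1 / 2)) (LW⁻¹ ^ 3) (towerM.B p K).K) :=
  sizeBound_of_dressedStabilityWith dressedStabilityWith_towerM_allCutoffs p K

/-! ## §2 ROOT-B's count data on the toys: one family felt per cube [decided toy] -/

/-- [decided toy] On W7's booking `BM K` exactly one family is felt at every cube, so the K-free positional count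
`PositionalCount (1·(LW⁴)^{k−j})` (ROOT-B's `hcountB`, `N₀ = 1`, `Λ = LW⁴ ≥ 1`) holds at every cutoff. [folklore] -/
theorem positionalCount_towerM (K : ℕ) : (BM K).PositionalCount fun j k => 1 * (LW ^ 4) ^ (k - j) := by
  intro q j
  have h1 : (((BM K).feltOfScale q j).card : ℝ) ≤ 1 := by
    exact_mod_cast (Finset.card_filter_le _ _).trans (Finset.card_singleton ()).le
  exact h1.trans (by simpa using one_le_pow₀ (M₀ := ℝ) (a := LW ^ 4) (n := (BM K).cubeScale q - j) (one_le_pow₀ one_le_LW))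

/-- [decided toy] The same on row W5's booking `BW K`. [folklore] -/
theorem positionalCount_towerW (K : ℕ) : (BW K).PositionalCount fun j k => 1 * (LW ^ 4) ^ (k - j) := by
  intro q j
  have h1 : (((BW K).feltOfScale q j).card : ℝ) ≤ 1 := by
    exact_mod_cast (Finset.card_filter_le _ _).trans (Finset.card_singleton ()).le
  exact h1.trans (by simpa using one_le_pow₀ (M₀ := ℝ) (a := LW ^ 4) (n := (BW K).cubeScale q - j) (one_le_pow₀ one_le_LW))

/-! ## §3 ROOT-B on the decided toys at every cutoff [decided toy] -/

/-- **ROOT-B ON W7's TOWER THROUGH THE END-ALL-slice-win BUDGET THEOREM** [decided toy]: for EVERY run-weight family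
`0 ≤ wt () K j ≤ w̄` (`j ≤ K`), `DressedBudget towerM wt` — ONE budget constant for every cube of every cutoff — by S3h-2 §2
`dressedBudget_swin_of_schedules` BY NAME: its whole binder list (§1's ≈ 45 estimate ∕ dictionary ∕ booking families, the weights,
the K-free positional counts `positionalCount_towerM`) inhabited AT ONCE on the toy with ONE schedule and ONE scalar set.  The
budget face is the CO-RECORDED root (typer R-T35 (i)); no earlier witness reaches it.  Nothing of Bałaban's densities; the weights
are external run data, not asserted. [folklore] -/
theorem dressedBudget_towerM_allCutoffs {wbar : ℝ} {wt : Unit → ℕ → ℕ → ℝ} (hwbar : 0 ≤ wbar)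
    (hw0 : ∀ p K, ∀ j ≤ K, 0 ≤ wt p K j) (hwb : ∀ p K, ∀ j ≤ K, wt p K j ≤ wbar) : DressedBudget towerM wt :=
  dressedBudget_swin_of_schedules towerM (κ := 1 / 2) (L := LW) (cbar := 0) (N₀ := 1) (A₀ := 1) (sbar := 1 / 2)
    (ρ' := 1 / 2) (r := 1) (cδ := 1 / 2) (m := 1 / 4) (w := fun _ _ => 1) (fun _ _ => Wm)
    (Fn := fun _ K _ k' k => FnM K k' k) (rel := fun _ _ _ _ _ U U' => U = U') (ref := fun _ _ _ _ U => U)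
    (base := fun _ _ _ _ => base₁) (𝒜 := fun _ _ _ _ => zeroExp) (𝒬 := fun _ K _ k => 𝒬M K k) (q := fun _ _ _ _ _ => 0)
    (μ := fun _ _ _ k => flAt (atomW (k + 1))) (z₀ := fun _ _ _ _ => 0) (z₁ := fun _ _ _ _ => 0)
    (defect := fun _ _ _ _ k => defW (k + 1)) (s := fun _ _ _ _ => 0) (s1 := fun _ K => s1M K) (Asz := fun _ K => AszM K)
    (S := fun _ _ _ b => {b}) (Sg := fun _ _ _ b => {(b, 0)}) (c := fun _ _ _ _ => (((1 / 4 : ℝ)) : ℂ))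
    (δf := fun _ _ _ k _ => dfW k) (creg := fun _ _ _ => 0)
    (fun _ _ => hratioM) one_le_LW le_rfl (by norm_num) zero_le_one zero_le_one (by norm_num) (locCell_LW _).le (by norm_num)
    (by norm_num) one_pos (by norm_num)
    (fun _ K b k' _ _ _ => birthSlice_anti_window (hslM K b k') (Wm.hwcw k'))
    (fun _ K _ k' k _ _ _ _ U => FnM_succ K k' k U) (fun _ _ _ _ k _ _ _ _ _ => mem_bddClass_flAt _ _)
    (fun _ _ _ _ k _ _ _ _ => realBaseAt_W _ _) (fun _ _ _ _ k _ _ _ _ => exponentSliceAt_M _ _ _ _)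
    (fun _ K b k => hQM K b k) (fun _ K => hSgM K) (fun _ _ _ _ => rfl)
    (fun _ K f k'' => aszRec_birth (TM K).gen (fun _ _ => 0) (s1M K) f k'')
    (fun _ K f _ _ _ hk => aszRec_succ (TM K).gen (fun _ _ => 0) (s1M K) f hk) (fun _ _ _ _ => hcmM)
    (fun _ K b k x hx => hδfM K k b x hx) (fun _ _ _ k _ _ => hδfwkM k) (fun _ _ _ k => hDμM k) (fun _ _ _ k => hz₁M k)
    (fun _ _ _ _ k _ _ _ _ U₀ _ pd _ _ => (relGauge_pairs k).mono fun z hz t _ => hz (latMove U₀ pd t))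
    (fun _ _ _ _ _ _ _ h => h ▸ rfl) (fun _ _ _ _ _ k _ => aesm_flAt _ _) (fun _ _ _ _ k => hdefwkM k)
    (fun _ _ _ k' k _ _ _ => hrateM k' k) (fun _ K b k' k _ _ _ _ ε hε => hlinM K b k' k ε hε)
    (fun _ _ _ => le_rfl) (fun _ _ _ _ => le_rfl) (fun _ K => hregM K _) (fun _ _ _ _ => by norm_num)
    (fun _ _ k _ _ _ => Nat.zero_le k) (fun _ K => hcountM K) (fun _ K => hbirthM K)
    hwbar hw0 hwb (fun _ K => positionalCount_towerM K)

/-- [decided toy] The closed instance: unit run weights, `DressedBudget towerM 1`. [folklore] -/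
theorem dressedBudget_towerM_one : DressedBudget towerM fun _ _ _ => 1 :=
  dressedBudget_towerM_allCutoffs (wbar := 1) zero_le_one (fun _ _ _ _ => zero_le_one) fun _ _ _ _ => le_rfl

/-- **ROOT-B WITH ITS CONSTANT DISPLAYED, AT EVERY CUBE OF EVERY CUTOFF** [decided toy]: for run weights `0 ≤ wt K j ≤ w̄` the toy's
booking at cutoff `K` carries the per-cube budget `Σ_{j ≤ k} wt K j · load ≤ w̄·(1·1∕(1 − ½))` — §1's class at cutoff `K`, the count
`positionalCount_towerM`, and the STRICT product `UW.hprod : LW⁴·ρ₁·LW⁻³ ≤ ½` through `DressedRootFam`'s `cubeBudget_of_classAt_strict`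
BY NAME.  (The existential `DressedBudget` hides this constant; here it is the cell's `c_B = w̄·N₀A₀∕(1−ρ′)` literally.) [folklore] -/
theorem cubeBudget_towerM_allCutoffs {wbar : ℝ} {wt : ℕ → ℕ → ℝ} (hwbar : 0 ≤ wbar) (hw0 : ∀ K, ∀ j ≤ K, 0 ≤ wt K j)
    (hwb : ∀ K, ∀ j ≤ K, wt K j ≤ wbar) (K : ℕ) :
    (BM K).CubeBudget (wt K) (wbar * (1 * 1 / (1 - 1 / 2))) := by
  obtain ⟨hA₀, hρ₁, hτ0, hτ1, hcl⟩ := dressedStabilityWith_towerM_allCutoffs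
  exact cubeBudget_of_classAt_strict (Λ := LW ^ 4) hA₀ hρ₁ hτ0 hτ1 zero_le_one (pow_nonneg LW_pos.le 4)
    (by rw [prod_cell LW_pos]; exact (locCell_LW _).le) (by norm_num) hwbar (hw0 K) (hwb K) (positionalCount_towerM K)
    (hcl () K)

/-- **ROOT-B ON ROW W5's TOWER** [decided toy]: for EVERY run-weight family `0 ≤ wt () K j ≤ w̄`, `DressedBudget towerW wt` by S3g-2's
`dressedBudget_win_of_cell` over W5c's With-form `dressedStabilityWith_towerW_allCutoffs` BY NAME, with the count
`positionalCount_towerW` — the window-face toy reaches the co-recorded budget root too. [folklore] -/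
theorem dressedBudget_towerW_allCutoffs {wbar : ℝ} {wt : Unit → ℕ → ℕ → ℝ} (hwbar : 0 ≤ wbar)
    (hw0 : ∀ p K, ∀ j ≤ K, 0 ≤ wt p K j) (hwb : ∀ p K, ∀ j ≤ K, wt p K j ≤ wbar) : DressedBudget towerW wt :=
  dressedBudget_win_of_cell dressedStabilityWith_towerW_allCutoffs one_le_LW zero_le_one (locCell_LW _).le (by norm_num) hwbar
    hw0 hwb fun _ K => positionalCount_towerW K

/-- [decided toy] The closed instance: unit run weights, `DressedBudget towerW 1`. [folklore] -/
theorem dressedBudget_towerW_one : DressedBudget towerW fun _ _ _ => 1 :=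
  dressedBudget_towerW_allCutoffs (wbar := 1) zero_le_one (fun _ _ _ _ => zero_le_one) fun _ _ _ _ => le_rfl

end Summit.QuantumFields.BalabanUV.T4Continuum.NE1p.DressedTowerWitnessSliceAllCutoffs

end
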